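import Summits.NavierStokesRegularity.NavierStokesRegularity.Theses.LerayQuarterDissipation
import Summits.NavierStokesRegularity.NavierStokesRegularity.Theses.SymmetryModuliCount
import Summits.NavierStokesRegularity.NavierStokesRegularity.Theses.ExtremalTypeIConstant
import Summits.NavierStokesRegularity.NavierStokesRegularity.Theses.AdaptedFrequency
import Summits.NavierStokesRegularity.NavierStokesRegularity.Theorems.LerayQuarterDissipationFiniteDissipationLiouvilleHardness
import Summits.NavierStokesRegularity.NavierStokesRegularity.Theorems.LerayQuarterDissipationFiniteDissipationLiouvilleGlue
import Summits.NavierStokesRegularity.NavierStokesRegularity.Theorems.LerayQuarterDissipationRecurrentReductionD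
import Summits.NavierStokesRegularity.NavierStokesRegularity.Theorems.LerayQuarterDissipationRecordTimeTypeI
import HarnessLib

/-!
# Route `LerayQuarterDissipation`: the DAG edges of its open cruxes, kernel-checked

Theorems file (seat ns-lqd-p1 g2; bookkeeping corollaries of landed proofs, `--supports` the
cruxes). Navier–Stokes regularity is NOT proved by anything here; no summit is. Every theorem is
an IMPLICATION between named open statements of the tree (or a consequence of one), so that the
ledger's "if X is proved / refuted, then …" reads are modus ponens:

* `finiteDissipationLiouville_iff_recurrentDissipativeLiouville` — the glued split of the crux
  `FiniteDissipationLiouville` (FDL, stmt-22144) moved ALL its difficulty into child 2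
  `RecurrentDissipativeLiouville` (RDL, stmt-22508): with child 1 `RecurrentReductionD`
  (stmt-22507, PROVED `recurrentReductionD_proof`) and the glue (stmt-22509, PROVED) the two cruxes
  are EQUIVALENT;
* `typeIDSSLiouvilleConjecture_of_recurrentDissipativeLiouville`,
  `rotatedTypeIDSSLiouville_of_recurrentDissipativeLiouville`,
  `not_recurrentDissipativeLiouville_of_isTypeIDSSProfile` — hence RDL, like FDL
  (`…Hardness.typeIDSSLiouvilleConjecture_of_finiteDissipationLiouville`, p588754), implies the full
  catalogued wall `TypeIDSSLiouvilleConjecture` (plain AND rotated `λ`-DSS Liouville, every `λ`,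
  every `R ∈ O(3)`; Bradshaw–Tsai 2017 OP 5.1, Tsai Conj. 8.8–8.9), and ANY Type-I rotated-DSS
  profile refutes it;
* `finiteDissipationLiouville_of_typeIAncientLiouville`, `…_of_typeIAncientLiouville'`,
  `recurrentDissipativeLiouville_of_typeIAncientLiouville` — the route text's "FDL is weaker than
  (L′)": the KNSS-gauge Type-I Liouville statement `TypeIAncientLiouville` (stmt-4050; routes
  SymmetryModuliCount / ExtremalTypeIConstant, same text) implies FDL and RDL (its hypothesis is
  `IsTypeIAncientMild C u` unfolded, `isTypeIAncientMild_iff`; a vanishing field is bounded at the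
  apex);
* `noTypeII_of_enstrophyQuarterLaw` — the route's RESIDUAL `EnstrophyQuarterLaw` (EQL, stmt-1574,
  shared) implies the hard core `NoTypeII` (stmt-0056; copy `Theses.AdaptedFrequency.NoTypeII`, all
  copies have the same text) through the PROVED support `RecordTimeTypeI`
  (`lerayQuarterDissipation_recordTimeTypeI_proof`, eI ⇒ vI): the DAG edge 1574 ⇒ 0056 announced by
  the route's planner (evidence on stmt-1574, 2026-08-27), now in the tree.
-/

noncomputable section

-- the summit and its single sub-problem share the name (CONVENTIONS §1), as in every Theorems file
set_option linter.dupNamespace false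

namespace Summit.NavierStokesRegularity.NavierStokesRegularity.Theorems.FiniteDissipationLiouville.Links

open MeasureTheory Set Filter
open Literature.Analysis Literature.Analysis.FluidPDE

/-! ### FDL ⟺ RDL -/

/-- **The split is an equivalence**: `FiniteDissipationLiouville ↔ RecurrentDissipativeLiouville`.
(`→`: RDL is FDL restricted to uniformly recurrent members of the stratum; `←`: the PROVED child
`RecurrentReductionD` and the PROVED glue `FiniteDissipationLiouvilleGlue`.) -/
theorem finiteDissipationLiouville_iff_recurrentDissipativeLiouville :
    Theses.LerayQuarterDissipation.FiniteDissipationLiouville ↔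
      Theses.LerayQuarterDissipation.RecurrentDissipativeLiouville :=
  ⟨fun hF C K w hw hD _ => hF C K w hw hD,
    fun hR => finiteDissipationLiouvilleGlue_proof recurrentReductionD_proof hR⟩

/-! ### RDL implies the full (rotated) Type-I DSS Liouville wall -/

/-- **RDL implies the rotated Type-I `λ`-DSS Liouville statement** `RotatedTypeIDSSLiouville λ R`
for every `λ` and `R ∈ O(3)` (through FDL). -/
theorem rotatedTypeIDSSLiouville_of_recurrentDissipativeLiouville
    (hR : Theses.LerayQuarterDissipation.RecurrentDissipativeLiouville) (c : ℝ)
    (R : EuclideanSpace ℝ (Fin 3) ≃ₗᵢ[ℝ] EuclideanSpace ℝ (Fin 3)) :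
    RotatedTypeIDSSLiouville c R :=
  Hardness.rotatedTypeIDSSLiouville_of_finiteDissipationLiouville
    (finiteDissipationLiouville_iff_recurrentDissipativeLiouville.2 hR) c R

/-- **Hardness certificate for the child crux `RecurrentDissipativeLiouville`**: it implies the
catalogued open conjecture `TypeIDSSLiouvilleConjecture` (plain and rotated, every `λ`). -/
theorem typeIDSSLiouvilleConjecture_of_recurrentDissipativeLiouville
    (hR : Theses.LerayQuarterDissipation.RecurrentDissipativeLiouville) :
    _root_.Summit.NavierStokesRegularity.NavierStokesRegularity.TypeIDSSLiouvilleConjecture :=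
  fun c => ⟨Hardness.typeIDSSLiouville_of_recurrentDissipativeLiouville hR c,
    fun R => rotatedTypeIDSSLiouville_of_recurrentDissipativeLiouville hR c R⟩

/-- **Kill criterion for the child crux, full strength**: any Type-I ROTATED-DSS profile
(`IsTypeIDSSProfile c R u`, any `R ∈ O(3)`) refutes `RecurrentDissipativeLiouville`. -/
theorem not_recurrentDissipativeLiouville_of_isTypeIDSSProfile {c : ℝ}
    {R : EuclideanSpace ℝ (Fin 3) ≃ₗᵢ[ℝ] EuclideanSpace ℝ (Fin 3)}
    {u : ℝ → EuclideanSpace ℝ (Fin 3) → EuclideanSpace ℝ (Fin 3)} (h : IsTypeIDSSProfile c R u) :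
    ¬ Theses.LerayQuarterDissipation.RecurrentDissipativeLiouville :=
  fun hR => Hardness.not_finiteDissipationLiouville_of_isTypeIDSSProfile h
    (finiteDissipationLiouville_iff_recurrentDissipativeLiouville.2 hR)

/-! ### (L′) implies FDL and RDL -/

/-- **`TypeIAncientLiouville` (stmt-4050, route SymmetryModuliCount's copy) implies FDL**: the
Liouville statement on the whole KNSS-gauge Type-I class makes every member of the stratum vanish,
hence bounded at the apex. -/
theorem finiteDissipationLiouville_of_typeIAncientLiouville
    (hL : Theses.SymmetryModuliCount.TypeIAncientLiouville) :
    Theses.LerayQuarterDissipation.FiniteDissipationLiouville := by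
  intro C K u hu _ hsing
  have hz : ∀ t < 0, ∀ x, u t x = 0 := hL C u (isTypeIAncientMild_iff.1 hu)
  obtain ⟨t, ht, x, -, hM⟩ := hsing 1 one_pos 0
  rw [hz t ht.2 x, norm_zero] at hM
  exact lt_irrefl 0 hM

/-- The same from route ExtremalTypeIConstant's copy of `TypeIAncientLiouville` (stmt-4050; identical
text). -/
theorem finiteDissipationLiouville_of_typeIAncientLiouville'
    (hL : Theses.ExtremalTypeIConstant.TypeIAncientLiouville) :
    Theses.LerayQuarterDissipation.FiniteDissipationLiouville :=
  finiteDissipationLiouville_of_typeIAncientLiouville hL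

/-- **`TypeIAncientLiouville` (stmt-4050) implies RDL** (through FDL). -/
theorem recurrentDissipativeLiouville_of_typeIAncientLiouville
    (hL : Theses.SymmetryModuliCount.TypeIAncientLiouville) :
    Theses.LerayQuarterDissipation.RecurrentDissipativeLiouville :=
  finiteDissipationLiouville_iff_recurrentDissipativeLiouville.1
    (finiteDissipationLiouville_of_typeIAncientLiouville hL)

/-! ### The residual EQL implies the hard core NoTypeII -/

/-- **EQL ⇒ NoTypeII** (DAG edge stmt-1574 ⇒ stmt-0056): the enstrophy quarter law for every maximal
classical Leray–Hopf solution from a rapidly decaying datum implies that every such blow-up runs at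
the velocity Type-I rate — by the route's PROVED record-time capacity lemma `RecordTimeTypeI`
(eI ⇒ vI, `lerayQuarterDissipation_recordTimeTypeI_proof`). Stated against the copy
`Theses.AdaptedFrequency.NoTypeII` of the hard core (all copies share the text). -/
theorem noTypeII_of_enstrophyQuarterLaw
    (hQ : Theses.LerayQuarterDissipation.EnstrophyQuarterLaw) : Theses.AdaptedFrequency.NoTypeII := by
  intro ν T hν hT u p hmax hLH hdec
  obtain ⟨K, hK⟩ := hQ ν T hν hT u p hmax hLH hdec
  exact lerayQuarterDissipation_recordTimeTypeI_proof ν T hν hT u p hmax.1 hLH hdec K hK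

end Summit.NavierStokesRegularity.NavierStokesRegularity.Theorems.FiniteDissipationLiouville.Links

end
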